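/-
COR-CM (cell pub-hodgecm2, stage 2 of the Hodge ladder) — count-neutral kernel combinatorics (seat prover-pub-hodgecm2-b23-g57-0, binder
prover b23, gen 57; lane SYLOW TRANSFER XVIII «order 8m, 3 ∤ m: the normal odd complement», blanket `Census/SylowTransfer*` HOME/INBOX.md l.23357,
claim l.26753).  Pure group theory (Mathlibʼs Burnside transfer `MonoidHom.transferSylow` twice); no definition, no certificate, no `decide`, no named
fact, no geometry, no `sorry`.  `Interfaces.lean` (C1), every E term, B01 and `Transposition/*` are untouched.
HONEST FRAMING: `HC_CM` is NOT proved, here or anywhere in the tree; nothing here is a period or a headline.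
-/
import Mathlib

/-!
# Sylow transfer, XVIII: every group of order `8m` (`m` odd, `3 ∤ m`) with a central involution has a normal subgroup of order `m`

Which rows of order `8m` are NOT of the form `M ⋊ P` (`M ⊴ G` of odd order `m`, `P` a Sylow `2`-subgroup)?  With a central involution `c` the
quotient `Ḡ = G/⟨c⟩` has order `4m` and an abelian Sylow `2`-subgroup `P̄` of order `4`; `N(P̄)/C(P̄)` embeds in `Aut(P̄) ≤ Sym(P̄)` (order `24`)
and has order dividing `[Ḡ : P̄] = m`, so it is trivial as soon as `3 ∤ m`; Burnsideʼs transfer then gives a normal complement `K̄ ⊴ Ḡ` of order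
`m`, whose preimage `K' ⊴ G` has order `2m` with the central Sylow `2`-subgroup `⟨c⟩`, so Burnside again (Mathlibʼs `IsCyclic.isComplement'`) splits
`K' = M × ⟨c⟩`; `M` is the unique subgroup of order `m` of `K'`, hence normal in `G`.  (For `3 ∣ m` this fails exactly at `SL(2,3)`, `SL(2,3) × C_{m/3}`,
`Q₈ ⋊ C₉`, …, and at the perfect groups `SL(2,q)`, `q ≡ ±3 (mod 8)` — e.g. `SL(2,5)` of order `120`.)

* §1 `normalizer_le_centralizer_of_card_eq_four`: a Sylow `2`-subgroup of order `4` whose index is prime to `3` is central in its normaliser.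
* §2 **`exists_normal_card_eq_of_card_eq_eight_mul`**: `|G| = 8m`, `m` odd, `3 ∤ m`, `c` a central involution `≠ 1` ⟹ `∃ M ⊴ G`, `|M| = m`;
  §3: every element of odd order lies in `M` (`mem_of_odd_orderOf`), so an element `z` of order `m` generates it (`zpowers_eq_of_orderOf_eq`) and
  `⟨z⟩ ⊴ G` (`zpowers_normal_of_card_eq_eight_mul`) — gen 53 XIVʼs `p ≥ 5` normality without the prime-power hypothesis.
CENSUS READING: for `3 ∤ m` the open rows of order `8m` are exactly `M ⋊ P` with `M` non-cyclic, or `M` cyclic with a mixed (non-`±1`) action of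
`P/⟨c⟩` (part XV closes the reflected ones).  All [folklore].

## References
* [Pohlmann1968] H. Pohlmann, Algebraic cycles on abelian varieties of complex multiplication type, Ann. of Math. 88 (1968), Thm 1.
* [Milne1999] J. S. Milne, Lefschetz motives and the Tate conjecture, Compositio Math. 117 (1999), Prop. 2.1, p. 54.
-/

namespace Summit.HodgeConjecture.CorCM.Census.SylowTransfer

open Subgroup

section Structure

variable {G : Type*} [Group G]

/-! ## §1 A Sylow `2`-subgroup of order `4` with index prime to `3` is central in its normaliser -/

/-- `|Aut(P)|` divides `|P|!` (the automorphisms embed in the permutations). [folklore] -/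
theorem card_mulAut_dvd_factorial (P : Type*) [Group P] [Finite P] : Nat.card (MulAut P) ∣ (Nat.card P).factorial := by
  rw [← Nat.card_perm]
  exact card_dvd_of_injective (MulAut.toPerm (M := P)) fun a b h => MulEquiv.toEquiv_injective (by
    have := congrArg (fun e : Equiv.Perm P => (e : P ≃ P)) h
    exact this)

/-- (`2⁴·…`) `4! = 24`. [folklore] -/
theorem factorial_four : (4 : ℕ).factorial = 24 := by decide

/-- **A Sylow `2`-subgroup `P` of order `4` with `3 ∤ [G : P]` satisfies `N(P) ≤ C(P)`**: `N(P)/C(P) ↪ Aut(P)` has order dividing `24` and dividing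
the odd, `3`-free index. [folklore] -/
theorem normalizer_le_centralizer_of_card_eq_four [Finite G] (P : Sylow 2 G) (hP : Nat.card P = 4)
    (h3 : ¬ 3 ∣ (P : Subgroup G).index) :
    normalizer (P : Set G) ≤ centralizer (P : Set G) := by
  haveI : Fact (Nat.Prime 2) := ⟨Nat.prime_two⟩
  haveI : IsMulCommutative (P : Subgroup G) :=
    IsPGroup.isMulCommutative_of_card_eq_prime_sq (p := 2) (G := (P : Subgroup G)) (by rw [hP]; norm_num)
  have key := card_dvd_of_injective _ (QuotientGroup.kerLift_injective (P : Subgroup G).normalizerMonoidHom)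
  rw [normalizerMonoidHom_ker, ← index, ← relIndex] at key
  have h24 : Nat.card (MulAut P) ∣ 24 := by
    have h := card_mulAut_dvd_factorial P
    rwa [hP, factorial_four] at h
  have hidx : (centralizer (P : Set G)).relIndex (normalizer (P : Set G)) ∣ (P : Subgroup G).index :=
    (relIndex_dvd_of_le_left _ P.le_centralizer).trans (relIndex_dvd_index_of_le P.le_normalizer)
  have h2 : ¬ 2 ∣ (P : Subgroup G).index := P.not_dvd_index
  set x := (centralizer (P : Set G)).relIndex (normalizer (P : Set G)) with hx
  have hx24 : x ∣ 24 := key.trans h24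
  have hcop : Nat.Coprime x 24 := by
    rw [show (24 : ℕ) = 2 ^ 3 * 3 by norm_num]
    refine Nat.Coprime.mul_right (Nat.Coprime.pow_right _ ?_) ?_
    · rw [Nat.coprime_comm, Nat.Prime.coprime_iff_not_dvd Nat.prime_two]
      exact fun h => h2 (h.trans hidx)
    · rw [Nat.coprime_comm, Nat.Prime.coprime_iff_not_dvd Nat.prime_three]
      exact fun h => h3 (h.trans hidx)
  exact relIndex_eq_one.mp (hcop.eq_one_of_dvd hx24)

/-! ## §2 The normal odd complement -/

/-- `(2ᵏ·m).factorization 2 = k` for odd `m` (private copy of the sieve laneʼs `FriedlanderIwaniecPrimes.factorization_two_pow_mul_odd`, kept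
private so as not to import analytic number theory into the census). [folklore] -/
private theorem factorization_two_pow_mul_odd' {m : ℕ} (hm : Odd m) (k : ℕ) : (2 ^ k * m).factorization 2 = k := by
  have hm0 : m ≠ 0 := by rintro rfl; exact (Nat.not_odd_zero hm).elim
  rw [Nat.factorization_mul (pow_ne_zero k two_ne_zero) hm0, Finsupp.add_apply, Nat.Prime.factorization_pow Nat.prime_two,
    Finsupp.single_eq_same, Nat.factorization_eq_zero_of_not_dvd (fun h => Nat.not_even_iff_odd.mpr hm (even_iff_two_dvd.mpr h)), add_zero]

/-- A central cyclic subgroup is normal. [folklore] -/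
theorem zpowers_normal_of_central {c : G} (hcen : ∀ w : G, w * c = c * w) : (zpowers c).Normal := by
  refine ⟨fun n hn g => ?_⟩
  obtain ⟨k, rfl⟩ := mem_zpowers_iff.mp hn
  have hcomm : g * c ^ k = c ^ k * g := ((Commute.zpow_right (show Commute g c from hcen g) k)).eq
  rw [hcomm, mul_inv_cancel_right]
  exact hn

/-- In a group of odd order `m`, no: **a subgroup of `P`-coprime order maps trivially to a `2`-group** — the counting step: a subgroup whose order is odd
and divides `2` is trivial. [folklore] -/
theorem eq_one_of_dvd_two_of_dvd_odd {d m : ℕ} (hm : Odd m) (h2 : d ∣ 2) (hdm : d ∣ m) : d = 1 := by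
  rcases (Nat.dvd_prime Nat.prime_two).mp h2 with h | h
  · exact h
  · subst h
    exact absurd (even_iff_two_dvd.mpr hdm) (Nat.not_even_iff_odd.mpr hm)

/-- **EVERY GROUP OF ORDER `8m` (`m` ODD, `3 ∤ m`) WITH A CENTRAL INVOLUTION HAS A NORMAL SUBGROUP OF ORDER `m`** (so `G = M ⋊ P`). [folklore] -/
theorem exists_normal_card_eq_of_card_eq_eight_mul [Finite G] (c : G) {m : ℕ} (hm : Odd m) (h3 : ¬ 3 ∣ m)
    (hG : Nat.card G = 8 * m) (hc2 : c * c = 1) (hc1 : c ≠ 1) (hcen : ∀ w : G, w * c = c * w) :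
    ∃ M : Subgroup G, M.Normal ∧ Nat.card M = m := by
  classical
  haveI : Fact (Nat.Prime 2) := ⟨Nat.prime_two⟩
  have hm0 : 0 < m := hm.pos
  -- the central subgroup `Z = ⟨c⟩` of order `2` and the quotient of order `4m`
  set Z := zpowers c with hZ
  haveI hZn : Z.Normal := zpowers_normal_of_central hcen
  have hordc : orderOf c = 2 := orderOf_eq_prime (by rw [pow_two, hc2]) hc1
  have hZcard : Nat.card Z = 2 := by rw [hZ, Nat.card_zpowers, hordc]
  have hQcard : Nat.card (G ⧸ Z) = 4 * m := by
    have h := card_eq_card_quotient_mul_card_subgroup Z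
    rw [hG, hZcard] at h
    omega
  -- a Sylow `2`-subgroup of the quotient: order `4`, index `m`
  obtain ⟨P⟩ := (Sylow.nonempty : Nonempty (Sylow 2 (G ⧸ Z)))
  have hPcard : Nat.card P = 4 := by
    rw [Sylow.card_eq_multiplicity, hQcard, show (4 : ℕ) = 2 ^ 2 by norm_num, factorization_two_pow_mul_odd' hm 2]
  have hPidx : (P : Subgroup (G ⧸ Z)).index = m := by
    have h := (P : Subgroup (G ⧸ Z)).card_mul_index
    rw [hPcard, hQcard] at h
    exact Nat.eq_of_mul_eq_mul_left (by norm_num : 0 < 4) h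
  -- Burnside in the quotient
  have hN := normalizer_le_centralizer_of_card_eq_four P hPcard (by rw [hPidx]; exact h3)
  set K := (MonoidHom.transferSylow P hN).ker with hK
  have hKc : IsComplement' K (P : Subgroup (G ⧸ Z)) := MonoidHom.ker_transferSylow_isComplement' P hN
  have hKcard : Nat.card K = m := by rw [← hKc.index_eq_card, hPidx]
  have hKidx : K.index = 4 := by
    have h := K.card_mul_index
    rw [hKcard, hQcard, mul_comm] at h
    exact Nat.eq_of_mul_eq_mul_right hm0 h
  -- its preimage `K' ⊴ G` of order `2m`, containing `c`
  set K' := K.comap (QuotientGroup.mk' Z) with hK'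
  haveI hK'n : K'.Normal := Normal.comap inferInstance _
  have hK'idx : K'.index = 4 := by rw [hK', K.index_comap_of_surjective (QuotientGroup.mk'_surjective Z), hKidx]
  have hK'card : Nat.card K' = 2 * m := by
    have h := K'.card_mul_index
    rw [hK'idx, hG] at h
    omega
  have hcK' : c ∈ K' := by
    rw [hK', mem_comap, QuotientGroup.mk'_apply, (QuotientGroup.eq_one_iff c).mpr (mem_zpowers c)]
    exact one_mem K
  -- Burnside in `K'`: the Sylow `2`-subgroup has order `2` (the smallest prime) and is cyclic
  obtain ⟨P₂⟩ := (Sylow.nonempty : Nonempty (Sylow 2 K'))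
  have hP₂card : Nat.card P₂ = 2 := by
    rw [Sylow.card_eq_multiplicity, hK'card, show (2 : ℕ) * m = 2 ^ 1 * m by rw [pow_one], factorization_two_pow_mul_odd' hm 1, pow_one]
  have hcyc : IsCyclic P₂ := isCyclic_of_prime_card hP₂card
  have hmin : (Nat.card K').minFac = 2 := by
    rw [hK'card]
    exact (Nat.minFac_eq_two_iff _).mpr (dvd_mul_right 2 m)
  have hC := IsCyclic.isComplement' hmin hcyc
  set K₂ := (MonoidHom.transferSylow P₂ (hcyc.normalizer_le_centralizer hmin)).ker with hK₂
  have hP₂idx : (P₂ : Subgroup K').index = m := by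
    have h := (P₂ : Subgroup K').card_mul_index
    rw [hP₂card, hK'card] at h
    exact Nat.eq_of_mul_eq_mul_left (by norm_num : 0 < 2) h
  have hK₂card : Nat.card K₂ = m := by rw [← hC.index_eq_card, hP₂idx]
  -- `M = K₂` seen in `G`
  set M := K₂.map K'.subtype with hM
  have hMcard : Nat.card M = m := by rw [hM, card_map_of_injective K'.subtype_injective, hK₂card]
  have hMle : M ≤ K' := map_subtype_le K₂
  -- uniqueness: every subgroup of `K'` of order `m` is `M`
  have huniq : ∀ M₂ : Subgroup G, M₂ ≤ K' → Nat.card M₂ = m → M₂ = M := by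
    intro M₂ hM₂ hcard₂
    set M₂' := M₂.subgroupOf K' with hM₂'
    have hM₂'card : Nat.card M₂' = m := by rw [hM₂', Nat.card_congr (subgroupOfEquivOfLe hM₂).toEquiv, hcard₂]
    have hle : M₂' ≤ K₂ := by
      rw [hK₂, ← Subgroup.map_eq_bot_iff, ← card_eq_one]
      set V := MonoidHom.transferSylow P₂ (hcyc.normalizer_le_centralizer hmin)
      have h1 : Nat.card (M₂'.map V) ∣ m := by
        have h := card_map_dvd M₂' V
        rwa [hM₂'card] at h
      have h2 : Nat.card (M₂'.map V) ∣ 2 := by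
        have h := card_subgroup_dvd_card (M₂'.map V)
        rwa [hP₂card] at h
      exact eq_one_of_dvd_two_of_dvd_odd hm h2 h1
    have hle' : M₂ ≤ M := by
      intro x hx
      have hx' : (⟨x, hM₂ hx⟩ : K') ∈ M₂' := mem_subgroupOf.mpr hx
      exact mem_map.mpr ⟨⟨x, hM₂ hx⟩, hle hx', rfl⟩
    exact eq_of_le_of_card_ge hle' (by rw [hMcard, hcard₂])
  -- normality: conjugates of `M` are subgroups of `K'` of order `m`
  refine ⟨M, ⟨fun n hn g => ?_⟩, hMcard⟩
  set Mg := M.map (MulAut.conj g).toMonoidHom with hMg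
  have hMgle : Mg ≤ K' := by
    rintro _ ⟨x, hx, rfl⟩
    exact hK'n.conj_mem x (hMle hx) g
  have hMgcard : Nat.card Mg = m := by rw [hMg, card_map_of_injective (MulAut.conj g).injective, hMcard]
  have hEq := huniq Mg hMgle hMgcard
  have hmem : g * n * g⁻¹ ∈ Mg := mem_map.mpr ⟨n, hn, rfl⟩
  rwa [hEq] at hmem

/-! ## §3 Consequences: odd-order elements, an element of order `m` -/

/-- **Every element of odd order lies in the normal odd complement** (its image in `G/M`, a group of order `8`, is trivial). [folklore] -/
theorem mem_of_odd_orderOf [Finite G] {M : Subgroup G} (hMn : M.Normal) (hidx : M.index = 8) {g : G} (hg : Odd (orderOf g)) : g ∈ M := by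
  have h8 : orderOf (QuotientGroup.mk' M g) ∣ 8 := by
    rw [← hidx, index_eq_card]
    exact orderOf_dvd_natCard _
  have hodd : Odd (orderOf (QuotientGroup.mk' M g)) := Odd.of_dvd_nat hg (orderOf_map_dvd _ g)
  have h1 : orderOf (QuotientGroup.mk' M g) = 1 := by
    have hcop : Nat.Coprime (orderOf (QuotientGroup.mk' M g)) 8 := by
      rw [show (8 : ℕ) = 2 ^ 3 by norm_num]
      exact Nat.Coprime.pow_right _ (Nat.coprime_two_right.mpr hodd)
    exact hcop.eq_one_of_dvd h8
  rw [orderOf_eq_one_iff, QuotientGroup.mk'_apply, QuotientGroup.eq_one_iff] at h1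
  exact h1

/-- **An element of order `m` generates the normal odd complement.** [folklore] -/
theorem zpowers_eq_of_orderOf_eq [Finite G] {M : Subgroup G} (hMn : M.Normal) (hidx : M.index = 8) {m : ℕ} (hm : Odd m)
    (hMcard : Nat.card M = m) {z : G} (hz : orderOf z = m) : zpowers z = M := by
  have hle : zpowers z ≤ M := zpowers_le.mpr (mem_of_odd_orderOf hMn hidx (by rw [hz]; exact hm))
  exact eq_of_le_of_card_ge hle (by rw [hMcard, Nat.card_zpowers, hz])

/-- **`|G| = 8m`, `m` odd, `3 ∤ m`, `c` a central involution `≠ 1`, `z` of order `m` ⟹ `⟨z⟩ ⊴ G`** — gen 53 XIVʼs normality (`p ≥ 5`) for every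
such `m`, with no cyclicity of the odd part assumed a priori. [folklore] -/
theorem zpowers_normal_of_card_eq_eight_mul [Finite G] (c : G) {m : ℕ} (hm : Odd m) (h3 : ¬ 3 ∣ m)
    (hG : Nat.card G = 8 * m) (hc2 : c * c = 1) (hc1 : c ≠ 1) (hcen : ∀ w : G, w * c = c * w) (z : G) (hz : orderOf z = m) :
    (zpowers z).Normal := by
  obtain ⟨M, hMn, hMcard⟩ := exists_normal_card_eq_of_card_eq_eight_mul c hm h3 hG hc2 hc1 hcen
  have hidx : M.index = 8 := by
    have h := M.card_mul_index
    rw [hMcard, hG, mul_comm] at h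
    exact Nat.eq_of_mul_eq_mul_right hm.pos h
  rw [zpowers_eq_of_orderOf_eq hMn hidx hm hMcard hz]
  exact hMn

/-- **… hence every conjugate of `z` is a power of `z`** (the input of gen 53ʼs `…_of_normal_zpowers_prime_pow` in element form). [folklore] -/
theorem conj_mem_zpowers_of_card_eq_eight_mul [Finite G] (c : G) {m : ℕ} (hm : Odd m) (h3 : ¬ 3 ∣ m)
    (hG : Nat.card G = 8 * m) (hc2 : c * c = 1) (hc1 : c ≠ 1) (hcen : ∀ w : G, w * c = c * w) (z : G) (hz : orderOf z = m) (w : G) :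
    w * z * w⁻¹ ∈ zpowers z :=
  (zpowers_normal_of_card_eq_eight_mul c hm h3 hG hc2 hc1 hcen z hz).conj_mem z (mem_zpowers z) w

end Structure

end Summit.HodgeConjecture.CorCM.Census.SylowTransfer
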